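import Summits.BirchSwinnertonDyer.Rank1Residual.Additive.GordDescentModelFree
import HarnessLib

/-!
# X3♯(G-ord) / X4♯(G-ord), defect 2: the class theorems MODEL-FREE and DATUM-FREE (II: all cells; X3; rank 0 one-sided)

HONEST FRAMING (cell `b2b-bsdres`, run/shared/lean/b2b/bsd-rank1-residual/, verbatim in every
file): the goal of the cell is to DELETE the COMBINATION-SHAPED residual classes of the
Birch–Swinnerton-Dyer formula for ALL analytic-rank `≤ 1` elliptic curves over `ℚ` — "full BSD
formula for every rank `≤ 1` curve in class `C`" assembled STRICTLY from published theorems — so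
that the rank-`≤ 1` remainder becomes exactly the CONSTRUCTION-SHAPED classes, which are TYPED
(missing-input `Prop`s), NOT attempted. This is not "finishing BSD". Sub-cell `additive-p2`
(CLASS-OWNERS row "X3/X4 additive — pot. good ordinary / X3♯(G-ord)"), generation 4: research
route; no claim beyond the stated classes; theorems only, no definition, no new named fact;
X3♯(G-ord)/X4♯(G-ord) stay CONSTRUCTION-SHAPED.

Continuation of `GordDescentModelFree.lean` (same conventions: `p ≥ 5`, `W` globally minimal,
`e = semistabilityIndex W p = 2`, the quadratic field of discriminant `p*` constructed, the good
ordinary twist produced from the theory class by gen 4's `exists_goodOrd_twist_pStar_of_typeGOrd`,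
the over-`K` input model-free on `W.baseChange K`):

* `bsdp_of_classX4Gord_two_cases` — X4♯(G-ord) ∩ I₀* with NO surjectivity hypothesis: `BSD(E,p)`
  ⇐ over-`K` input ∧ [typed X9 input of the twist pair if of class X9] ∧ [typed X10 input if of
  class X10] (CM twists are rows C8/C10); model-free form of gen 2's
  `bsdp_of_classX4_of_goodOrd_twist_cases`.
* `bsdp_of_classX3Gord_two_cases`, `bsdp_of_classX3_of_subGordTwo_cases` — X3♯(G-ord) ∩ I₀*:
  `BSD(E,p)` ⇐ over-`K` input ∧ [typed X1 input of the twist pair `(E^{(p*)}, p)` if it is of class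
  X1]; the twist is good ordinary with NO datum (gen 3 `classX3Gord_of_subGordTwo`). Census (gen 2
  `TWIST-CENSUS.md`): 301 X3 e = 2 pairs — 57 Covered twist pairs, 243 X1 twist pairs, 1 twist of
  analytic rank 2 (outside `hrd`).
* `bsdp_of_classX4Gord_two_of_lowerOverC_of_kim`, `bsdp_iff_lowerOverC_of_classX4Gord_two_of_kim` —
  X4♯(G-ord) ∩ I₀* ∩ {`r_an(E) = 0`, `ρ̄` onto, Manin `p ∤ c_D`, `p ∤ ∏ c_ℓ`}: the residue is ONE
  inequality `ord_p #Ш_an(E_K) ≤ ord_p #Ш(E_K)` on the canonical model `W.baseChange K`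
  (`MissingLowerBoundOverCAt`), the upper half over `ℚ` being Kim 2026 Thm. 1.8 (6) (additive-p4's
  `X4RankZero`); and `BSDp W p ↔` that inequality for ANY quadratic `K` with `d_K = p*`. The
  inequality is what Burungale–Skinner–Tian–Wan arXiv:2409.01350v2 Thm. 1.21(c) ANNOUNCES (Kato's
  main conjecture for `f_E = f_{E′} ⊗ χ_K`, `p ∣ d_K`; OPEN hypothesis by the cell rule, not used;
  HOME/b2b-bsdres-additive-p2/BSTW121C-X4GORD.md: 214 ‖ 44 rank-0 pairs).

Located gap UNCHANGED; nothing here books a pair.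

References: A. Burungale, F. Castella, C. Skinner, IMRN 2025 Cor. 1.3.1; C.-H. Kim, Amer. J. Math.
148 (2026) Thm. 1.8; J. S. Milne, Invent. Math. 17 (1972) Thm. 1; C. Wuthrich, J. London Math.
Soc. 89 (2014) Prop. 21; A. Burungale, C. Skinner, Y. Tian, X. Wan, arXiv:2409.01350v2 Thm. 1.21(c)
(PRE); D. Delbourgo, Compositio Math. 113 (1998) p. 151.
-/

noncomputable section

open scoped Classical NumberField

open WeierstrassCurve IsDedekindDomain NumberField Literature.NumberTheory.EllipticCurves
  Literature.NumberTheory.EllipticCurves.Rank1Residual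
  Literature.NumberTheory.EllipticCurves.Rank1Residual.Typed
  Literature.NumberTheory.EllipticCurves.ModularForms
  Literature.NumberTheory.EllipticCurves.Wuthrich2014
  Summit.BirchSwinnertonDyer.Rank1Residual.AdditivePotMult

namespace Summit.BirchSwinnertonDyer.Rank1Residual.Additive

variable (W : WeierstrassCurve ℚ) [W.IsElliptic] [W.IsGloballyMinimal] (p : ℕ) [hp : Fact p.Prime]

/-! ## §1 X4♯(G-ord) ∩ I₀*, `p ≥ 5`, every cell of the twist pair -/

section X4

/-- **X4♯(G-ord) ∩ I₀*, `p ≥ 5`, all cells of the twist pair (no surjectivity hypothesis), model-free.**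
`BSD(E,p)` ⇐ the over-`K` input on `W.baseChange K` for the quadratic fields of discriminant `p*`
∧ [typed X9 input of the twist pair if it is of class X9] ∧ [typed X10 input if of class X10]
(both quantified over the globally minimal models of `E^{(p*)}`; CM twists are rows C8/C10). The
model-free form of gen 2's `bsdp_of_classX4_of_goodOrd_twist_cases`, with the twist datum produced
from the class. -/
theorem bsdp_of_classX4Gord_two_cases (hSk : Skinner2016.thmC_padicValRat_bsd_rank_zero)
    (hBCS : BurungaleCastellaSkinner2025.cor131_padicValRat_bsd_rank_le_one)
    (hJSW : JetchevSkinnerWan2017.thm121_padicValRat_bsd_rank_one)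
    (hCGS : CastellaGrossiSkinner2025.thmD_padicValRat_bsd_rank_le_one)
    (hGV : GreenbergVatsal2000.thm13_charIdeal_eq_of_gvPar) (hGr : greenberg_charValue_rankZero)
    (hmod : hasEntireLFunction_rat) (hmodP : nonempty_modularParametrizationData)
    (hGZK : rank_eq_analyticRank_of_analyticRank_le_one)
    (hCM : bsdTriple_of_hasCM_of_L_one_ne_zero) (hKob : Kobayashi2013.cor14_bsdp_of_cm_rank_one)
    (hYZ : YanZhu2026.thm415_padicValRat_bsd_rank_le_one)
    (hW20 : Wuthrich2014.lemma20_surjective_threeAdic_of_semistable)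
    (hLLT : LiLiuTian2024.thm11_bsdp_of_cm_rank_one)
    (hMilneC : Milne1972.bsdQuotient_baseChange_quadratic_anyModel)
    (hp5 : 5 ≤ p) (hX : ClassX4Gord W p) (he : semistabilityIndex W p = 2) (hr : W.analyticRank ≤ 1)
    (hrd : (W.quadraticTwist ((-1 : ℚ) ^ (p / 2) * p)).analyticRank ≤ 1)
    (hK : ∀ (K : Type) [Field K] [NumberField K], Module.finrank ℚ K = 2 →
      (NumberField.discr K : ℚ) = (-1 : ℚ) ^ (p / 2) * p → MissingPPartOverCAt (W.baseChange K) p)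
    (hX9 : ∀ (Wd : WeierstrassCurve ℚ) [Wd.IsElliptic] [Wd.IsGloballyMinimal],
      (∃ C : VariableChange ℚ, C • W.quadraticTwist ((-1 : ℚ) ^ (p / 2) * p) = Wd) →
      ClassX9 Wd p → X9.MissingInputAt Wd p)
    (hX10 : ∀ (Wd : WeierstrassCurve ℚ) [Wd.IsElliptic] [Wd.IsGloballyMinimal],
      (∃ C : VariableChange ℚ, C • W.quadraticTwist ((-1 : ℚ) ^ (p / 2) * p) = Wd) →
      ClassX10 Wd p → X10.MissingInputAt Wd) :
    BSDp W p := by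
  obtain ⟨K, iF, iN, h2, hdK⟩ := exists_quadraticField_discr_pStar p (by omega)
  obtain ⟨Wd, iWd, iWdm, C, hC, hord⟩ := exists_goodOrd_twist_pStar_of_typeGOrd W p hp5 hX.typeGOrd he
  haveI := W.isElliptic_quadraticTwist (pStar_ne_zero p)
  have hrd' : Wd.analyticRank ≤ 1 := by rw [← hC, analyticRank_smul]; exact hrd
  have hWdK : ∃ C : VariableChange ℚ, C • W.quadraticTwist (NumberField.discr K : ℚ) = Wd := by
    rw [hdK]; exact ⟨C, hC⟩
  have hd : BSDp Wd p :=
    bsdp_twist_pStar_of_classX4_cases W p Wd hSk hBCS hJSW hCGS hGV hGr hmod hmodP hGZK hCM hKob hYZ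
      hW20 hLLT hX.classX4 ⟨C, hC⟩ hord hrd' (hX9 Wd ⟨C, hC⟩) (hX10 Wd ⟨C, hC⟩)
  exact bsdp_of_pPartOverC_baseChange W p K Wd hGZK hmod hMilneC hr h2 hWdK hrd' (hK K h2 hdK) hd

end X4

/-! ## §2 X3♯(G-ord) ∩ I₀*, `p ≥ 5`: model-free, datum-free -/

section X3

/-- **X3♯(G-ord) ∩ I₀*, `p ≥ 5` — the complete relocation, model-free and datum-free.** For
`(E,p) ∈ X3♯(G-ord)` (`ClassX3Gord W p`; on the data cell this is `ClassX3 ∧ SubGordTwo`, gen 3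
`classX3Gord_of_subGordTwo`) with `e = 2`, `r_an(E) ≤ 1`, `r_an(E^{(p*)}) ≤ 1`: `BSD(E,p)` follows
from the over-`K` input `MissingPPartOverCAt (W.baseChange K) p` for the quadratic fields of
discriminant `p*` TOGETHER WITH the cell's typed X1 input of the twist pair `(E^{(p*)}, p)` when
that pair is of class X1 (quantified over the globally minimal models of `E^{(p*)}`; the Covered
cases — CM rows C8/C10, non-anomalous C6, rank-0 GV C7 — need nothing). Census (gen 2,
`TWIST-CENSUS.md`): of the 301 X3 e = 2 pairs, 57 have a Covered twist pair, 243 an X1 twist pair,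
1 a twist of analytic rank 2 (outside the hypothesis `hrd`). [cite: Wuthrich2014, Prop. 21 (p. 400)] -/
theorem bsdp_of_classX3Gord_two_cases (hSk : Skinner2016.thmC_padicValRat_bsd_rank_zero)
    (hBCS : BurungaleCastellaSkinner2025.cor131_padicValRat_bsd_rank_le_one)
    (hJSW : JetchevSkinnerWan2017.thm121_padicValRat_bsd_rank_one)
    (hCGS : CastellaGrossiSkinner2025.thmD_padicValRat_bsd_rank_le_one)
    (hGV : GreenbergVatsal2000.thm13_charIdeal_eq_of_gvPar) (hGr : greenberg_charValue_rankZero)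
    (hmod : hasEntireLFunction_rat) (hmodP : nonempty_modularParametrizationData)
    (hGZK : rank_eq_analyticRank_of_analyticRank_le_one)
    (hCM : bsdTriple_of_hasCM_of_L_one_ne_zero) (hKob : Kobayashi2013.cor14_bsdp_of_cm_rank_one)
    (hYZ : YanZhu2026.thm415_padicValRat_bsd_rank_le_one)
    (hW20 : Wuthrich2014.lemma20_surjective_threeAdic_of_semistable)
    (hLLT : LiLiuTian2024.thm11_bsdp_of_cm_rank_one) (hW : sha_dvd_analyticSha)
    (hMilneC : Milne1972.bsdQuotient_baseChange_quadratic_anyModel)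
    (hp5 : 5 ≤ p) (hX : ClassX3Gord W p) (he : semistabilityIndex W p = 2) (hr : W.analyticRank ≤ 1)
    (hrd : (W.quadraticTwist ((-1 : ℚ) ^ (p / 2) * p)).analyticRank ≤ 1)
    (hK : ∀ (K : Type) [Field K] [NumberField K], Module.finrank ℚ K = 2 →
      (NumberField.discr K : ℚ) = (-1 : ℚ) ^ (p / 2) * p → MissingPPartOverCAt (W.baseChange K) p)
    (hX1 : ∀ (Wd : WeierstrassCurve ℚ) [Wd.IsElliptic] [Wd.IsGloballyMinimal],
      (∃ C : VariableChange ℚ, C • W.quadraticTwist ((-1 : ℚ) ^ (p / 2) * p) = Wd) →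
      ClassX1 Wd p → X1.MissingInputAt Wd p) :
    BSDp W p := by
  obtain ⟨K, iF, iN, h2, hdK⟩ := exists_quadraticField_discr_pStar p (by omega)
  obtain ⟨Wd, iWd, iWdm, C, hC, hord⟩ := exists_goodOrd_twist_pStar_of_typeGOrd W p hp5 hX.typeGOrd he
  haveI := W.isElliptic_quadraticTwist (pStar_ne_zero p)
  have hrd' : Wd.analyticRank ≤ 1 := by rw [← hC, analyticRank_smul]; exact hrd
  have hWdK : ∃ C : VariableChange ℚ, C • W.quadraticTwist (NumberField.discr K : ℚ) = Wd := by
    rw [hdK]; exact ⟨C, hC⟩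
  have hd : BSDp Wd p :=
    bsdp_twist_pStar_of_classX3_cases W p Wd hSk hBCS hJSW hCGS hGV hGr hmod hmodP hGZK hCM hKob hYZ
      hW20 hLLT hW hX.classX3 (by omega) ⟨C, hC⟩ hord hrd' (hX1 Wd ⟨C, hC⟩)
  exact bsdp_of_pPartOverC_baseChange W p K Wd hGZK hmod hMilneC hr h2 hWdK hrd' (hK K h2 hdK) hd

/-- **X3 on the data cell** (`ClassX3 ∧ SubGordTwo`, `p ≥ 5`): the same conclusion with the census
predicate in place of the theory class (gen 3 `classX3Gord_of_subGordTwo`). [cite: Wuthrich2014, Prop. 21 (p. 400)] -/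
theorem bsdp_of_classX3_of_subGordTwo_cases (hSk : Skinner2016.thmC_padicValRat_bsd_rank_zero)
    (hBCS : BurungaleCastellaSkinner2025.cor131_padicValRat_bsd_rank_le_one)
    (hJSW : JetchevSkinnerWan2017.thm121_padicValRat_bsd_rank_one)
    (hCGS : CastellaGrossiSkinner2025.thmD_padicValRat_bsd_rank_le_one)
    (hGV : GreenbergVatsal2000.thm13_charIdeal_eq_of_gvPar) (hGr : greenberg_charValue_rankZero)
    (hmod : hasEntireLFunction_rat) (hmodP : nonempty_modularParametrizationData)
    (hGZK : rank_eq_analyticRank_of_analyticRank_le_one)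
    (hCM : bsdTriple_of_hasCM_of_L_one_ne_zero) (hKob : Kobayashi2013.cor14_bsdp_of_cm_rank_one)
    (hYZ : YanZhu2026.thm415_padicValRat_bsd_rank_le_one)
    (hW20 : Wuthrich2014.lemma20_surjective_threeAdic_of_semistable)
    (hLLT : LiLiuTian2024.thm11_bsdp_of_cm_rank_one) (hW : sha_dvd_analyticSha)
    (hMilneC : Milne1972.bsdQuotient_baseChange_quadratic_anyModel)
    (hp5 : 5 ≤ p) (hX : ClassX3 W p) (hS : SubGordTwo W p) (hr : W.analyticRank ≤ 1)
    (hrd : (W.quadraticTwist ((-1 : ℚ) ^ (p / 2) * p)).analyticRank ≤ 1)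
    (hK : ∀ (K : Type) [Field K] [NumberField K], Module.finrank ℚ K = 2 →
      (NumberField.discr K : ℚ) = (-1 : ℚ) ^ (p / 2) * p → MissingPPartOverCAt (W.baseChange K) p)
    (hX1 : ∀ (Wd : WeierstrassCurve ℚ) [Wd.IsElliptic] [Wd.IsGloballyMinimal],
      (∃ C : VariableChange ℚ, C • W.quadraticTwist ((-1 : ℚ) ^ (p / 2) * p) = Wd) →
      ClassX1 Wd p → X1.MissingInputAt Wd p) :
    BSDp W p :=
  bsdp_of_classX3Gord_two_cases W p hSk hBCS hJSW hCGS hGV hGr hmod hmodP hGZK hCM hKob hYZ hW20 hLLT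
    hW hMilneC hp5 (classX3Gord_of_subGordTwo W p hp5 hX hS) hS.2 hr hrd hK hX1

end X3

/-! ## §3 X4♯(G-ord) ∩ I₀*, rank 0, `p ≥ 5`, surj, Manin: ONE inequality on the canonical model -/

section OneSided

/-- **The residue is ONE inequality over `K`, model-free.** For `(E,p) ∈ X4♯(G-ord)` with `e = 2`,
`p ≥ 5`, `L(E,1) ≠ 0` (`r_an(E) = 0`), `ρ̄_{E,p}` onto, a modular parametrisation `D` with
`p ∤ c_D`, `p ∤ ∏_ℓ c_ℓ(E)`, and `r_an(E^{(p*)}) ≤ 1`: if `MissingLowerBoundOverCAt (W.baseChange K) p`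
(`ord_p #Ш_an(E_K/K) ≤ ord_p #Ш(E_K/K)` on the base-changed model) holds for the quadratic fields of
discriminant `p*`, then `BSD(E,p)` — the UPPER half over `ℚ` is Kim 2026 Thm. 1.8 (6) (`hKim`, via
additive-p4's `X4RankZero.bsdp_of_missingLowerBoundAt`), the lower half descends by additive-p1's
`missingLowerBoundAt_iff_overC`. The remaining inequality is what Burungale–Skinner–Tian–Wan
arXiv:2409.01350v2 Thm. 1.21(c) ANNOUNCES (Kato's main conjecture for `f_E = f_{E′} ⊗ χ_K`,
`p ∣ d_K`); OPEN hypothesis by the cell rule, not used.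
[cite: Kim2022StructureSelmer, Thm. 1.9 (6) (PDF p. 8)] [cite: BurungaleCastellaSkinner2025, Cor. 1.3.1 (p. 4)] -/
theorem bsdp_of_classX4Gord_two_of_lowerOverC_of_kim
    (hKim : Kim2026.rankZero_padicValNat_sha_le_of_maninConstant)
    (hGZK : rank_eq_analyticRank_of_analyticRank_le_one) (hmod : hasEntireLFunction_rat)
    (hMilneC : Milne1972.bsdQuotient_baseChange_quadratic_anyModel)
    (hBCS : BurungaleCastellaSkinner2025.cor131_padicValRat_bsd_rank_le_one)
    (hp5 : 5 ≤ p) (hX : ClassX4Gord W p) (he : semistabilityIndex W p = 2) (hrW : W.analyticRank = 0)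
    (hsurj : Surj W p) {N : ℕ} [NeZero N] (D : ModularParametrizationData W N)
    (hc : ¬ (p : ℤ) ∣ D.maninConstant) (htam : ¬ p ∣ W.tamagawaProduct)
    (hrd : (W.quadraticTwist ((-1 : ℚ) ^ (p / 2) * p)).analyticRank ≤ 1)
    (hlow : ∀ (K : Type) [Field K] [NumberField K], Module.finrank ℚ K = 2 →
      (NumberField.discr K : ℚ) = (-1 : ℚ) ^ (p / 2) * p →
        MissingLowerBoundOverCAt (W.baseChange K) p) :
    BSDp W p := by
  obtain ⟨K, iF, iN, h2, hdK⟩ := exists_quadraticField_discr_pStar p (by omega)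
  obtain ⟨Wd, iWd, iWdm, C, hC, hord⟩ := exists_goodOrd_twist_pStar_of_typeGOrd W p hp5 hX.typeGOrd he
  haveI := W.isElliptic_quadraticTwist (pStar_ne_zero p)
  haveI : (W.baseChange K).IsElliptic := by rw [baseChange]; infer_instance
  have hrd' : Wd.analyticRank ≤ 1 := by rw [← hC, analyticRank_smul]; exact hrd
  have hWdK : ∃ C : VariableChange ℚ, C • W.quadraticTwist (NumberField.discr K : ℚ) = Wd := by
    rw [hdK]; exact ⟨C, hC⟩
  have hr : W.analyticRank ≤ 1 := by rw [hrW]; exact zero_le_one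
  have hd : BSDp Wd p :=
    bsdp_twist_pStar_of_classX4_of_surj W p Wd hGZK hBCS hp5 hX.classX4 hsurj ⟨C, hC⟩ hord hrd'
  have hV : ∃ C : VariableChange K, C • W.baseChange K = W.baseChange K := ⟨1, one_smul _ _⟩
  obtain ⟨-, hfinW⟩ := hGZK W hr
  obtain ⟨-, hfinD⟩ := hGZK Wd hrd'
  obtain ⟨hshaK, hWR⟩ := hMilneC W K h2 Wd hWdK (W.baseChange K) hV hfinW hfinD
  have hlowQ : MissingLowerBoundAt W p :=
    (missingLowerBoundAt_iff_overC W p K Wd (W.baseChange K) hmod h2 hWdK hV hfinW hfinD hshaK hWR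
      hd).mpr (hlow K h2 hdK)
  exact X4RankZero.bsdp_of_missingLowerBoundAt W p hKim hGZK hmod hp5 hrW hX.classX4 hsurj D hc htam
    hlowQ

/-- **Exactness of the one-sided form**: on the same rows and for ANY quadratic `K` with `d_K = p*`,
`BSDp W p ↔ MissingLowerBoundOverCAt (W.baseChange K) p` (⇒: BSD gives the `p`-part over `ℚ`,
which relocates by `missingPPartOverCAt_baseChange_iff_bsdp` and is halved).
[cite: Kim2022StructureSelmer, Thm. 1.9 (6) (PDF p. 8)] [cite: BurungaleCastellaSkinner2025, Cor. 1.3.1 (p. 4)] -/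
theorem bsdp_iff_lowerOverC_of_classX4Gord_two_of_kim
    (hKim : Kim2026.rankZero_padicValNat_sha_le_of_maninConstant)
    (hGZK : rank_eq_analyticRank_of_analyticRank_le_one) (hmod : hasEntireLFunction_rat)
    (hMilneC : Milne1972.bsdQuotient_baseChange_quadratic_anyModel)
    (hBCS : BurungaleCastellaSkinner2025.cor131_padicValRat_bsd_rank_le_one)
    (hp5 : 5 ≤ p) (hX : ClassX4Gord W p) (he : semistabilityIndex W p = 2) (hrW : W.analyticRank = 0)
    (hsurj : Surj W p) {N : ℕ} [NeZero N] (D : ModularParametrizationData W N)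
    (hc : ¬ (p : ℤ) ∣ D.maninConstant) (htam : ¬ p ∣ W.tamagawaProduct)
    (hrd : (W.quadraticTwist ((-1 : ℚ) ^ (p / 2) * p)).analyticRank ≤ 1)
    (K : Type) [Field K] [NumberField K] (h2 : Module.finrank ℚ K = 2)
    (hdK : (NumberField.discr K : ℚ) = (-1 : ℚ) ^ (p / 2) * p) :
    BSDp W p ↔ MissingLowerBoundOverCAt (W.baseChange K) p := by
  have hr : W.analyticRank ≤ 1 := by rw [hrW]; exact zero_le_one
  refine ⟨fun hB ↦ ?_, fun hlow ↦ ?_⟩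
  · exact (lower_and_upper_of_missingPPartOverCAt _ p
      ((bsdp_iff_overC_of_classX4Gord_two_of_surj W p hGZK hmod hMilneC hBCS hp5 hX he hsurj hr hrd K
        h2 hdK).mp hB)).1
  · -- run the one-sided descent with THIS `K`
    obtain ⟨Wd, iWd, iWdm, C, hC, hord⟩ :=
      exists_goodOrd_twist_pStar_of_typeGOrd W p hp5 hX.typeGOrd he
    haveI := W.isElliptic_quadraticTwist (pStar_ne_zero p)
    haveI : (W.baseChange K).IsElliptic := by rw [baseChange]; infer_instance
    have hrd' : Wd.analyticRank ≤ 1 := by rw [← hC, analyticRank_smul]; exact hrd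
    have hWdK : ∃ C : VariableChange ℚ, C • W.quadraticTwist (NumberField.discr K : ℚ) = Wd := by
      rw [hdK]; exact ⟨C, hC⟩
    have hd : BSDp Wd p :=
      bsdp_twist_pStar_of_classX4_of_surj W p Wd hGZK hBCS hp5 hX.classX4 hsurj ⟨C, hC⟩ hord hrd'
    have hV : ∃ C : VariableChange K, C • W.baseChange K = W.baseChange K := ⟨1, one_smul _ _⟩
    obtain ⟨-, hfinW⟩ := hGZK W hr
    obtain ⟨-, hfinD⟩ := hGZK Wd hrd'
    obtain ⟨hshaK, hWR⟩ := hMilneC W K h2 Wd hWdK (W.baseChange K) hV hfinW hfinD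
    have hlowQ : MissingLowerBoundAt W p :=
      (missingLowerBoundAt_iff_overC W p K Wd (W.baseChange K) hmod h2 hWdK hV hfinW hfinD hshaK hWR
        hd).mpr hlow
    exact X4RankZero.bsdp_of_missingLowerBoundAt W p hKim hGZK hmod hp5 hrW hX.classX4 hsurj D hc htam
      hlowQ

end OneSided

end Summit.BirchSwinnertonDyer.Rank1Residual.Additive

end
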